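import Literature.MathematicalPhysics.QuantumFieldTheory.Balaban1983to89.B8LeafModelZd3Thm2
import Literature.MathematicalPhysics.QuantumFieldTheory.Balaban1983to89.B8LeafModelZd3Ineq165
import Literature.MathematicalPhysics.QuantumFieldTheory.Balaban1983to89.B8Eq142KLevelTouching

/-!
# `Balaban1983to89.B8LeafModelZd3Thm2Of135` — [Balaban1985RegularSpaces] THEOREM 2 (p. 83) **AS PRINTED — (1.35) ON THE LAYERS Λ_j —**
# on the `Ω₀ = ℤᵈ` sub-family of the N05 prototype `zdGF3`: the composite «`B8.Thm2Printed (famB8OfRecord …)` ((1.66)₁-typed t2 of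
# record) ∘ (1.65)» the chair's ruling ★★ R453 (C) names for the N05 count line, as ONE theorem

statement-level skeleton of published theorems with citation tags; proofs where landed; nothing here is a claim about the
Yang–Mills mass gap

PDF held: `paper:balaban1985-cmp99-regular-spaces-gauge-fixing` (journal page = PDF page + 74); p. 82 ((1.33)–(1.37)), p. 83 (Theorem 2, (1.42)),
p. 87 ((1.65)–(1.66)), p. 88 (Theorem 4, «Of course this theorem implies Theorem 2»), p. 77 ((1.3)–(1.6), bond convention).

WHY THIS FILE (cell `pub-ymgap`, seat `pub-ymgap-dag-n05-a` g6, KNIT seat of DAG node N05 = [B8]; chair ★★ R453 (A)–(C); count-neutral).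
R453: the t2 row of record for N05 is print's Theorem 2 with (1.35) ON Λ_j; the pin's `zdGF3.avgClose` is the (1.66)₁ box form (stronger
hypothesis ⇒ `thm2Printed_zd3_univ` is «Theorem 2 with (1.66)₁ for (1.35)»); the printed bridge (1.65) is `B8Ineq165AllLevels` /
`B8LeafModelZd3Ineq165` BY NAME; the count line cites the composite.  This file IS the composite, with the two displays the ruling asks for:
(i) the SHIFT `α₁ ↦ α₁″ := 11d²α₀ + α₁` in the smallness parameter of (1.36)/(1.39) (`C136 B₁ B₂ (α₀ + α₁″)`, `C139 B₁ (α₀ + α₁″)`; print's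
«constants depending on d and L only»: `B₁(α₀ + α₁″) ≤ B₁(1 + 11d²)(α₀ + α₁)`), coming from (1.65); (ii) **(1.37) at print's ORIGINAL `α₁`**
(`C137 α₁`: «B is given by formula (1.31) with |B − 1| … by the assumption (1.35)», p. 82) — NOT through (1.65): it is re-derived for the
gauge-fixed field by the (1.42) lemma in TOUCHING form (`B8Eq142KLevelTouching.H42_of_inAx_touching`) from (1.35) on Λ_j directly.  The index
law №11 («(1.6) at every level», `h16`) of the member is displayed (node00-def's `CarriersB8` v1.1 §2c carries it as a sub-family law).

WHAT IS PROVED (kernel, 0 sorry, theorems only): **`thm2_of135_zd3_univ`** — for `d, L ≥ 2` and the standing constants/sockets of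
`B8LeafModelZd3Thm2.thm2Printed_zd3_univ` (Theorem 4's `SockHFP₀`/`SockHFP`/`SockH59`/`SockP5u`, Proposition 3's `SockB9P3`, member-wise,
each below its threshold): `∃ B₁ B₂ c₁ > 0, ∀` members `i` of the `Ω₀ = ℤᵈ` sub-family carrying №11, `∀ α₀ α₁ > 0` with `α₀ + α₁ ≤ c₁`,
`∀ U₀, U′` with (1.33) `InA α₀ U₀`, `Reg335`, (1.34) `InAAx α₀ U₀ U′` and **(1.35) on Λ_j** (`‖(U′U₀)‾ʲ(c) − Ū₀ʲ(c)‖ ≤ α₁` on the level-`j`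
bonds `c` TOUCHING `Λs k j` with box in `Ω_j`, `j ≤ k`): there is a gauge transformation `u` with (1.29) such that `U₁ = U′^{u⁻¹}` satisfies
(1.36) `C136 B₁ B₂ (α₀ + α₁″)`, (1.37) `C137 α₁`, (1.38) `Landau`, (1.39) `C139 B₁ (α₀ + α₁″)`, and every `u′` with (1.29) and these four
properties equals `u`.

HONEST SCOPE.  Assembly BY NAME: `thm2Printed_zd3_univ` at `(α₀, α₁″)` fed by `avgClose_zdGF3_of135` ((1.65)); (1.37) at `α₁` by
`H42_of_inAx_touching` on the canonical masked logarithm of `U′^{u⁻¹}` (`mlogCfg_spec`); uniqueness = the instance's (a `u′` with `C137 α₁`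
has `C137 α₁″`).  The sockets remain hypotheses quantified over ALL members of `ZdIdx`; `≤` for print's `<`; `E j = SideTouches (Ω j)`; `Reg335
:= True` as in `zdGF3`.  Count-neutral; N05 NOT discharged; nothing continuum / ℝ⁴ / OS / mass-gap / Clay.  Unit `pub-ymgap-dag-n05-a` (g6),
2026-08-26.
-/

noncomputable section

open NormedSpace

namespace Literature.MathematicalPhysics.QuantumFieldTheory.Balaban1983to89.B8LeafModelZd3Thm2Of135

open Complex (I)
open B7Prop1Explicit B7Prop2Explicit B7Prop1Local B7Eq92Concrete
open B7Prop2Explicit (C0 c2')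
open B7Prop3Flat (c3)
open B8Ineq132 (InAk BondTouches Under)
open B8Eq119TwistedAxial (Restr129 InAx)
open B8Eq184Proof (cfgExp)
open B8Lemma1NonAbelian (mulCfg)
open B8Eq140Level (SideTouches)
open B8Eq146AExpansion (iEta)
open B8Ineq130 (tlo thi)
open B8Eq138LandauZd (IsLandau138W logCfg)
open B8Prop3GaugeFixedKLevel (mem_unitaryUnits_of_mgauge_eq)
open B8Thm4AtLandau138 (mgauge_mgauge_inv)
open B8LeafModelZd (SockH59 SockP5u ZdIdx)
open B8LeafModelZdOfHFP (SockHFP₀ SockHFP)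
open B8LeafModelZd3 (mlogCfg mlogCfg_spec zdGF3 SockB9P3 prop3_windows)
open B8LeafModelZd3Thm2 (thm2Printed_zd3_univ)
open B8LeafModelZd3Ineq165 (avgClose_zdGF3_of135)
open B8Eq142KLevelTouching (H42_of_inAx_touching)

-- `Site` alone could resolve to the torus sites of `Setup.lean`; re-export the `ℤ^d` sites of `B7Prop1Explicit`.
export B7Prop1Explicit (Site)

variable {d : ℕ}

section Thm2AsPrinted

variable {𝔸 : Type} [CStarAlgebra 𝔸] [Nontrivial 𝔸]

/-- **THEOREM 2 AS PRINTED — (1.35) ON THE LAYERS — on the `Ω₀ = ℤᵈ` sub-family of `zdGF3`** (p. 83; via p. 88 «Of course this theorem implies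
Theorem 2» and p. 87 (1.65)), for `d, L ≥ 2` and the constants/sockets of `B8LeafModelZd3Thm2.thm2Printed_zd3_univ`: `∃ B₁ B₂ c₁ > 0` such that
for every member `i` with `Ω 0 = univ` carrying the tower decomposition (1.6) at every level (index law №11, `h16`), every `α₀, α₁ > 0` with
`α₀ + α₁ ≤ c₁`, every background `U₀` with (1.33) (`InA α₀`) and datum `P` with (1.34) (`InAAx α₀`) and **(1.35) ON Λ_j**: closeness `≤ α₁` of the
level-`j` averages on the level-`j` bonds TOUCHING `Λs k j` (box in `Ω_j`), there is `u` with (1.29) such that `U′^{u⁻¹}` has (1.36) at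
`(B₁, B₂, α₀ + α₁″)`, **(1.37) at `α₁`**, (1.38), (1.39) at `(B₁, α₀ + α₁″)` — `α₁″ := 11d²α₀ + α₁` the displayed shift of (1.65) — and such a `u` is
unique.  See the module docstring for the assembly. [cite: Balaban1985RegularSpaces, Thm 2 p.83, (1.33)–(1.37) p.82, (1.65)–(1.66) p.87, Thm 4 p.88, (1.42) p.83, (1.6) p.77] -/
theorem thm2_of135_zd3_univ (hd2 : 2 ≤ d) {L : ℕ} (hL : 2 ≤ L) {β : ℝ} {len : Site d → ℝ}
    {B₀ B₀' B₀β cu cF₀ cF c59 cu' cB9 : ℝ} (hB₀ : 0 < B₀) (hB₀' : 0 < B₀') (hB₀β : 0 < B₀β) (hB : 2 ≤ 5 * (d : ℝ) * L * B₀)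
    (hcu : 0 < cu) (hcF₀ : 0 < cF₀) (hcF : 0 < cF) (hc59 : 0 < c59) (hcu' : 0 < cu') (hcB9 : 0 < cB9)
    (SHFP₀ : ∀ i : ZdIdx d L, SockHFP₀ (𝔸 := 𝔸) L B₀ B₀' cF₀ i.η i.k i.Ω i.Λs)
    (SHFP : ∀ i : ZdIdx d L, SockHFP (𝔸 := 𝔸) L B₀ B₀' cF i.η i.k i.Ω i.Λs)
    (SH59 : ∀ i : ZdIdx d L, SockH59 (𝔸 := 𝔸) L B₀ B₀' c59 i.η i.k i.Ω i.Λs i.Λb)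
    (SP5u : ∀ i : ZdIdx d L, SockP5u (𝔸 := 𝔸) L cu' cu i.η i.k i.Ω i.Λs)
    (SB9 : ∀ i : ZdIdx d L, SockB9P3 (𝔸 := 𝔸) L B₀ B₀β cB9 β len i.η i.k i.Ω i.Λs i.Λb) :
    ∃ B₁ B₂ c₁ : ℝ, 0 < B₁ ∧ 0 < B₂ ∧ 0 < c₁ ∧
      ∀ i : {i : ZdIdx d L // i.Ω 0 = Set.univ},
        (∀ ℓ, ℓ ≤ i.1.k → ∀ w : Site d, (∀ x, InBox (tlo L w ℓ) (thi L w ℓ) x → x ∈ i.1.Ω ℓ) →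
          ∃ j, ℓ ≤ j ∧ j ≤ i.1.k ∧ ∃ y ∈ i.1.Λs i.1.k j, Under L (j - ℓ) y w) →
        ∀ α₀ α₁ : ℝ, 0 < α₀ → 0 < α₁ → α₀ + α₁ ≤ c₁ →
          ∀ (U₀ : (zdGF3 𝔸 L β len i.1).Cfg) (P : (zdGF3 𝔸 L β len i.1).Pert),
            (zdGF3 𝔸 L β len i.1).InA α₀ U₀ → (zdGF3 𝔸 L β len i.1).Reg335 α₀ U₀ → (zdGF3 𝔸 L β len i.1).InAAx α₀ U₀ P →
            (∀ j, j ≤ i.1.k → ∀ (z : Site d) (μ : Fin d), BondTouches (i.1.Λs i.1.k j) z μ →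
              (∀ x, InBox (loK L j z) (bondHiK L j z μ) x → x ∈ i.1.Ω j) →
              ‖(avgIter L (mulCfg P.2.1 U₀.1) j z μ : 𝔸) - (avgIter L U₀.1 j z μ : 𝔸)‖ ≤ α₁) →
            ∃ u : (zdGF3 𝔸 L β len i.1).GT, (zdGF3 𝔸 L β len i.1).Restricted U₀ u ∧
              ((zdGF3 𝔸 L β len i.1).C136 B₁ B₂ (α₀ + (11 * (d : ℝ) ^ 2 * α₀ + α₁)) U₀ ((zdGF3 𝔸 L β len i.1).act P u) ∧
                (zdGF3 𝔸 L β len i.1).C137 α₁ U₀ ((zdGF3 𝔸 L β len i.1).act P u) ∧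
                (zdGF3 𝔸 L β len i.1).Landau U₀ ((zdGF3 𝔸 L β len i.1).act P u) ∧
                (zdGF3 𝔸 L β len i.1).C139 B₁ (α₀ + (11 * (d : ℝ) ^ 2 * α₀ + α₁)) U₀ ((zdGF3 𝔸 L β len i.1).act P u)) ∧
              ∀ u' : (zdGF3 𝔸 L β len i.1).GT, (zdGF3 𝔸 L β len i.1).Restricted U₀ u' →
                (zdGF3 𝔸 L β len i.1).C136 B₁ B₂ (α₀ + (11 * (d : ℝ) ^ 2 * α₀ + α₁)) U₀ ((zdGF3 𝔸 L β len i.1).act P u') →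
                (zdGF3 𝔸 L β len i.1).C137 α₁ U₀ ((zdGF3 𝔸 L β len i.1).act P u') →
                (zdGF3 𝔸 L β len i.1).Landau U₀ ((zdGF3 𝔸 L β len i.1).act P u') →
                (zdGF3 𝔸 L β len i.1).C139 B₁ (α₀ + (11 * (d : ℝ) ^ 2 * α₀ + α₁)) U₀ ((zdGF3 𝔸 L β len i.1).act P u') →
                  u' = u := by
  have hL1 : 1 ≤ L := le_trans (by norm_num) hL
  have hd1 : 1 ≤ d := le_trans (by norm_num) hd2
  have hd' : (1 : ℝ) ≤ d := by exact_mod_cast hd1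
  have hL' : (1 : ℝ) ≤ L := by exact_mod_cast hL1
  -- the (1.66)₁-typed instance (t2 of record at the pin) and Prop. 3's window threshold
  obtain ⟨B₁, B₂, c₁, hB₁, hB₂, hc₁, H⟩ := thm2Printed_zd3_univ (𝔸 := 𝔸) (β := β) (len := len) hd2 hL hB₀ hB₀' hB₀β hB hcu hcF₀ hcF
    hc59 hcu' hcB9 SHFP₀ SHFP SH59 SP5u SB9
  obtain ⟨cN, hcN, hwin⟩ := prop3_windows hd2 hL hB₀.le
  -- constants and the threshold
  set D : ℝ := 1 + 11 * (d : ℝ) ^ 2 with hD_def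
  have hD1 : 1 ≤ D := le_add_of_nonneg_right (by positivity)
  have hD0 : 0 < D := lt_of_lt_of_le one_pos hD1
  have hB₁D : 0 < B₁ * D := mul_pos hB₁ hD0
  set cT : ℝ := min (min (c₁ / D) cN) (min (min (1 / (6 * D)) (cN / (B₁ * D))) (min (1 / (16 * (B₁ * D))) (1 / (8 * (d : ℝ) * L))))
    with hcT_def
  have hcT : 0 < cT :=
    lt_min (lt_min (div_pos hc₁ hD0) hcN) (lt_min (lt_min (by positivity) (div_pos hcN hB₁D)) (lt_min (by positivity) (by positivity)))
  refine ⟨B₁, B₂, cT, hB₁, hB₂, hcT, ?_⟩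
  intro i h16 α₀ α₁ hα₀ hα₁ hs U₀ P hInA hReg hInAAx h35
  have hS0 : 0 < α₀ + α₁ := add_pos hα₀ hα₁
  -- unpack the threshold
  have hsc₁ : α₀ + α₁ ≤ c₁ / D := hs.trans ((min_le_left _ _).trans (min_le_left _ _))
  have hsN : α₀ + α₁ ≤ cN := hs.trans ((min_le_left _ _).trans (min_le_right _ _))
  have hs6 : α₀ + α₁ ≤ 1 / (6 * D) := hs.trans ((min_le_right _ _).trans ((min_le_left _ _).trans (min_le_left _ _)))
  have hsNB : α₀ + α₁ ≤ cN / (B₁ * D) := hs.trans ((min_le_right _ _).trans ((min_le_left _ _).trans (min_le_right _ _)))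
  have hs16 : α₀ + α₁ ≤ 1 / (16 * (B₁ * D)) := hs.trans ((min_le_right _ _).trans ((min_le_right _ _).trans (min_le_left _ _)))
  have hs8 : α₀ + α₁ ≤ 1 / (8 * (d : ℝ) * L) := hs.trans ((min_le_right _ _).trans ((min_le_right _ _).trans (min_le_right _ _)))
  -- the shifted closeness constant `α₁″ = 11d²α₀ + α₁`
  set α₁'' : ℝ := 11 * (d : ℝ) ^ 2 * α₀ + α₁ with hα₁''_def
  have h11 : 0 ≤ 11 * (d : ℝ) ^ 2 * α₀ := by positivity
  have hα₁'' : 0 < α₁'' := by rw [hα₁''_def]; linarith only [h11, hα₁]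
  have hα₁le : α₁ ≤ α₁'' := by rw [hα₁''_def]; linarith only [h11]
  have hsum : α₀ + α₁'' ≤ D * (α₀ + α₁) := by
    have e : D * (α₀ + α₁) = α₀ + α₁'' + 11 * (d : ℝ) ^ 2 * α₁ := by rw [hD_def, hα₁''_def]; ring
    rw [e]; linarith only [show (0 : ℝ) ≤ 11 * (d : ℝ) ^ 2 * α₁ by positivity]
  have hsumc : α₀ + α₁'' ≤ c₁ := by
    have h := mul_le_mul_of_nonneg_left hsc₁ hD0.le
    rw [mul_div_cancel₀ _ hD0.ne'] at h
    exact hsum.trans h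
  -- the windows of (1.65) at `α₀`
  have hα₀N : α₀ ≤ cN := by linarith only [hsN, hα₁]
  obtain ⟨hα3, hα4, -, -, -, -, -, -, -⟩ := hwin α₀ α₀ hα₀ hα₀N hα₀.le hα₀N
  have hα2 : 2 * α₀ ≤ c2' d L := by linarith only [hα4, hα₀]
  have hsm : 11 * (d : ℝ) ^ 2 * α₀ + α₁ ≤ 1 / 6 := by
    have h := mul_le_mul_of_nonneg_left hs6 hD0.le
    have e : D * (1 / (6 * D)) = 1 / 6 := by field_simp
    rw [e] at h
    have : α₁'' ≤ α₀ + α₁'' := le_add_of_nonneg_left hα₀.le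
    linarith only [this, hsum, h]
  -- (1.65): the member's `avgClose` at `α₁″`
  have havg : (zdGF3 𝔸 L β len i.1).avgClose α₁'' U₀ P :=
    avgClose_zdGF3_of135 hd1 hL i.1 h16 hα₀ hα3 hα2 hα₁.le hsm U₀ P hInA hInAAx h35
  -- the (1.66)₁-typed THEOREM 2 at `(α₀, α₁″)`
  obtain ⟨u, hR, ⟨h136, -, hLan, h139⟩, huniq⟩ := H i α₀ α₁'' hα₀ hα₁'' hsumc U₀ P hInA hReg hInAAx havg
  -- (1.37) at print's `α₁`, by the (1.42) lemma in touching form on the canonical masked logarithm of `U′^{u⁻¹}`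
  obtain ⟨hP1, h34, hAx⟩ := hInAAx
  subst hP1
  have hu : ∀ x, u.1 x ∈ unitaryUnits 𝔸 := u.2.1
  have hW : mgauge P.1.1 u.1 (mgauge P.1.1 u.1⁻¹ P.2.1) = P.2.1 := mgauge_mgauge_inv P.1.1 P.2.1 u.1
  have hWu : ∀ x κ, mgauge P.1.1 u.1⁻¹ P.2.1 x κ ∈ unitaryUnits 𝔸 := mem_unitaryUnits_of_mgauge_eq P.1.2 P.2.2 hu hW
  have hcs0 : 0 ≤ B₁ * (α₀ + α₁'') := by positivity
  have hα₂N : B₁ * (α₀ + α₁'') ≤ cN := by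
    have h := mul_le_mul_of_nonneg_left hsNB hB₁D.le
    rw [mul_div_cancel₀ _ hB₁D.ne'] at h
    calc B₁ * (α₀ + α₁'') ≤ B₁ * (D * (α₀ + α₁)) := mul_le_mul_of_nonneg_left hsum hB₁.le
      _ = B₁ * D * (α₀ + α₁) := by ring
      _ ≤ cN := h
  have hc16 : 16 * (B₁ * (α₀ + α₁'')) ≤ 1 := by
    have h := mul_le_mul_of_nonneg_left hs16 (show (0 : ℝ) ≤ 16 * (B₁ * D) by positivity)
    have e : 16 * (B₁ * D) * (1 / (16 * (B₁ * D))) = 1 := by field_simp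
    rw [e] at h
    calc 16 * (B₁ * (α₀ + α₁'')) ≤ 16 * (B₁ * (D * (α₀ + α₁))) := by gcongr
      _ = 16 * (B₁ * D) * (α₀ + α₁) := by ring
      _ ≤ 1 := h
  have hWA : ∀ j, j ≤ i.1.k → ∀ y τ, SideTouches (i.1.Ω j) y τ →
      mgauge P.1.1 u.1⁻¹ P.2.1 y τ = cfgExp i.1.η (logCfg i.1.η (mgauge P.1.1 u.1⁻¹ P.2.1)) y τ ∧
        ‖logCfg i.1.η (mgauge P.1.1 u.1⁻¹ P.2.1) y τ‖ ≤ (B₁ * (α₀ + α₁'')) * ((L : ℝ) ^ j * i.1.η)⁻¹ :=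
    fun j hj y τ h => ⟨(h136.1 j hj (y, τ) h).1, (h136.1 j hj (y, τ) h).2.2⟩
  obtain ⟨hA'sa, hA'eq, -⟩ := mlogCfg_spec i.1.hη hL1 i.1.k P.1.1 hWu hcs0 hc16 i.1.Ω hWA
  set A' := mlogCfg i.1.k i.1.η i.1.Ω (mgauge P.1.1 u.1⁻¹ P.2.1) with hA'_def
  have hA'bd : ∀ j, j ≤ i.1.k → ∀ y τ, SideTouches (i.1.Ω j) y τ →
      mgauge P.1.1 u.1⁻¹ P.2.1 y τ = cfgExp i.1.η A' y τ ∧ ‖A' y τ‖ ≤ (B₁ * (α₀ + α₁'')) * ((L : ℝ) ^ j * i.1.η)⁻¹ := by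
    intro j hj y τ h
    obtain ⟨hAA, hWexp⟩ := hA'eq j hj y τ h
    exact ⟨hWexp, by rw [hAA]; exact (hWA j hj y τ h).2⟩
  -- the windows of the (1.42) lemma at `α₂ := B₁(α₀ + α₁″)`
  obtain ⟨-, -, h16w, -, hsmallw, hc₃w, -, -, -⟩ := hwin α₀ (B₁ * (α₀ + α₁'')) hα₀ hα₀N hcs0 hα₂N
  have hsmall₁ : (d : ℝ) * L * α₁ ≤ 1 / 8 := by
    have h := mul_le_mul_of_nonneg_left hs8 (show (0 : ℝ) ≤ (d : ℝ) * L by positivity)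
    have e : (d : ℝ) * L * (1 / (8 * (d : ℝ) * L)) = 1 / 8 := by field_simp
    rw [e] at h
    have : (d : ℝ) * L * α₁ ≤ (d : ℝ) * L * (α₀ + α₁) := mul_le_mul_of_nonneg_left (by linarith only [hα₀]) (by positivity)
    exact this.trans h
  have h137 : (zdGF3 𝔸 L β len i.1).C137 α₁ P.1 ((zdGF3 𝔸 L β len i.1).act P u) :=
    H42_of_inAx_touching hd2 i.1.hη hL i.1.k P.1.2 hα₀ hα₁ hcs0 hα3 hα4 h16w hsmallw hc₃w hsmall₁ i.1.Ω i.1.hΩ (i.1.Λs i.1.k)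
      (i.1.Λb i.1.k) (i.1.hbox i.1.k le_rfl) (i.1.hclass i.1.k le_rfl) hInA h34 (hAx i.1.k le_rfl) h35 u.1
      (mgauge P.1.1 u.1⁻¹ P.2.1) A' hu hW hR hA'sa hA'bd
  -- conclusion; uniqueness is the instance's, (1.37) being monotone in `α₁`
  refine ⟨u, hR, ⟨h136, h137, hLan, h139⟩, ?_⟩
  intro u' hR' h136' h137' hLan' h139'
  refine huniq u' hR' h136' ?_ hLan' h139'
  intro j hj c hc
  have hmono : 2 * (d : ℝ) * L * α₁ ≤ 2 * d * L * α₁'' := mul_le_mul_of_nonneg_left hα₁le (by positivity)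
  exact (h137' j hj c hc).trans_le hmono

end Thm2AsPrinted

#print axioms thm2_of135_zd3_univ

end Literature.MathematicalPhysics.QuantumFieldTheory.Balaban1983to89.B8LeafModelZd3Thm2Of135

end
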